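import Summits.QuantumFields.YangMills.Theorems.LuscherReductionTwistedTraceScalingFloorMass
import Summits.QuantumFields.YangMills.Theorems.TwistedTraceScaling.Negative.FloorRouteCeiling
import HarnessLib

/-!
# R15 §3–§4 (crux `TwistedTraceScaling`, stmt-QuantumFields-20203): the exponent ceiling of lane A's floor route in the EXACT currency of F5
# `levelValue_zero_ge_floor` (p595053) — the pre-asymptotic floor is `< Λ_id·e^{−β^{−c}}` for every `c ≥ 1/6` on the log design, and for every
# `c ≥ 17/150` at the polynomial scales `τ = β^{−1/3}`, `ρ = β^{−12/25}`, `γ = β^{7/10}` of `…FloorScales` (every `L`, `μ > 0`, `s > 0`, `β ≥ 1`)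

Standing disprover `ym-cdisprove-20203-1` (gen 14), sequel to `…Negative.FloorRouteCeiling` (R15 §1–§2, p595644).  Lane A's F5 (`…FloorMass`, ★★★ `levelValue_zero_ge_floor`)
reads the k = 0 floor off the pointwise sub-solution bound: `λ₀(β,L) ≥ floorF5 := m − (m·e^{−2γτ²} + floorCK·floorTail)/floorMass(s)`,
`m = floorCK·e^{−riccatiTrialErr}·e^{−γ(2τδ₁ + δ₁²)}·e^{−floorDefect}·√(π/β)^{|E|·3}·e^{−6·toronZPE L (1/2) 0 0}`, `δ₁ = chartMove L ρ = |E|·√2·ρ`; F6 (`…FloorScales` p1,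
`…FloorAssembly`) takes `τ = β^{−1/3}`, `ρ = β^{−12/25}`, `γ = β^{7/10}`, `s = β^{−1/2}` and bounds every error exponent by `K·β^{−1/10}`.  This file bounds `floorF5` from ABOVE:
* §3 `floorDefect_nonneg'`; ★ `floorF5_le` — for `β, μ > 0`, `ρ, τ ≥ 0`, `s > 0` (any `γ`):
  `floorF5 ≤ N_free(β)·e^{−6Z₀(L)}·exp(−66·β·ρ·tubeSigma L τ·√N)·exp(−γ(2τδ₁ + δ₁²))` (drop the remainder, `e^{−riccatiTrialErr} ≤ 1`, `e^{−floorDefect} ≤ 1`, and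
  `R15.floorCK_mul_gauss_le`);
* §4 ★★ `floorF5_lt_idealFloor_target` — log design (`τ ≥ A·β^{−1/3}`, `C·log β/β ≤ ρ²`): for every `c ≥ 1/6`, eventually `floorF5 < Λ_id(β)·e^{−β^{−c}}` (all `μ > 0`,
  `γ ≥ 0`, `s > 0`); ★★ `floorF5_lt_idealFloor_target_scales` — at the polynomial scales of `…FloorScales`, for every `c ≥ 17/150` and EVERY `β ≥ 1`:
  `floorF5 < Λ_id(β)·e^{−β^{−c}}` (all `μ > 0`, `s > 0`): the cut-off cross term alone gives `γ·2τδ₁ = 2√2·|E|·β^{−17/150} > β^{−c}`.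
READING.  `VacuumFloorAt L Λ_id tol` (`Λ_id·e^{−tol} ≤ λ₀` eventually) fed by F5 needs `Λ_id·e^{−tol} ≤ floorF5`, hence `tol(β) > 2√2|E|·β^{−17/150}` at lane A's scales
(and `tol ≫ √(log β)·β^{−1/6}` on any log design): the announced `tol = K·β^{−1/10}` is CONSISTENT (`1/10 < 17/150 < 11/75 < 1/6`), and cannot be sharpened below
`β^{−17/150}` along this route; the hand-over window `p < 2/51` (R14) is untouched.  NO KILL of the crux, of F5, or of F6 as announced.
HONEST FRAMING: fixed-lattice `SU(2)` bookkeeping about explicit constants of a stub lane (S-BASE C3d FLOOR) of a child of the CONDITIONAL reduction route (femto rung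
R2b1); not `¬TwistedTraceScaling`, not infinite volume, not a gap, not Clay.  Sorry-free, no new definition; axioms ⊆ {propext, Classical.choice, Quot.sound}.

## References
* M. Lüscher, Nucl. Phys. B219 (1983) 233, §3. [Luscher1983]
-/

set_option autoImplicit false

noncomputable section

open Real
open Literature.MathematicalPhysics.QuantumFieldTheory
open Literature.MathematicalPhysics.QuantumLattice
open Summit.QuantumFields.YangMills.Theorems.FemtoTransferGap
open Summit.QuantumFields.YangMills.Theorems.FemtoTransferGap.TwoLattice
open Summit.QuantumFields.YangMills.Theorems.FemtoTransferGap.TwoLattice.Toron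
open Summit.QuantumFields.YangMills.Theorems.FemtoTransferGap.TwoLattice.Cov

namespace Summit.QuantumFields.YangMills.Theorems.TwistedTraceScaling.Negative.R15

/-! ## §3 The F5 floor from above -/

/-- `floorDefect L β μ τ ≥ 0` for `β, μ > 0`, `τ ≥ 0`. [folklore] -/
theorem floorDefect_nonneg' (L : ℕ) [NeZero L] {β μ τ : ℝ} (hβ : 0 < β) (hμ : 0 < μ) (hτ : 0 ≤ τ) : 0 ≤ floorDefect L β μ τ := by
  unfold floorDefect; positivity

/-- ★ **The pre-asymptotic floor of `levelValue_zero_ge_floor`, from above** (`β, μ > 0`, `ρ, τ ≥ 0`, `s > 0`, any `γ`):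
`floorF5 ≤ N_free(β)·e^{−6·toronZPE L (1/2) 0 0}·exp(−66·β·ρ·tubeSigma L τ·√N)·exp(−γ(2τδ₁ + δ₁²))`. [cite: Luscher1983, §3] -/
theorem floorF5_le (L : ℕ) [NeZero L] {β μ γ ρ τ s : ℝ} (hβ : 0 < β) (hμ : 0 < μ) (hρ : 0 ≤ ρ) (hτ : 0 ≤ τ) (hs : 0 < s) :
    floorCK L β ρ τ * (Real.exp (-riccatiTrialErr L β μ ρ (tubeSigma L τ)) * Real.exp (-(γ * (2 * τ * chartMove L ρ + chartMove L ρ ^ 2))) *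
        Real.exp (-floorDefect L β μ τ) * (Real.sqrt (π / β) ^ (Fintype.card (Edge 3 L) * 3) * Real.exp (-(6 * toronZPE L (1 / 2) 0 0)))) -
      (floorCK L β ρ τ * (Real.exp (-riccatiTrialErr L β μ ρ (tubeSigma L τ)) * Real.exp (-(γ * (2 * τ * chartMove L ρ + chartMove L ρ ^ 2))) *
        Real.exp (-floorDefect L β μ τ) * (Real.sqrt (π / β) ^ (Fintype.card (Edge 3 L) * 3) * Real.exp (-(6 * toronZPE L (1 / 2) 0 0)))) *
          Real.exp (-(2 * γ * τ ^ 2)) + floorCK L β ρ τ * floorTail L β ρ) / floorMass L β μ γ s ≤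
      (Real.exp (2 * β) * Real.sqrt (π / β) ^ 3 / (2 * π ^ 2)) ^ Fintype.card (Edge 3 L) * Real.exp (-(6 * toronZPE L (1 / 2) 0 0)) *
        Real.exp (-(66 * β * ρ * tubeSigma L τ * Real.sqrt (Fintype.card (Plaquette 3 L × Fin 3) : ℝ))) *
        Real.exp (-(γ * (2 * τ * chartMove L ρ + chartMove L ρ ^ 2))) := by
  set CK : ℝ := floorCK L β ρ τ with hCK
  set XE : ℝ := Real.exp (-riccatiTrialErr L β μ ρ (tubeSigma L τ)) with hXE
  set Xγ : ℝ := Real.exp (-(γ * (2 * τ * chartMove L ρ + chartMove L ρ ^ 2))) with hXγ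
  set XD : ℝ := Real.exp (-floorDefect L β μ τ) with hXD
  set G : ℝ := Real.sqrt (π / β) ^ (Fintype.card (Edge 3 L) * 3) with hG
  set Z : ℝ := Real.exp (-(6 * toronZPE L (1 / 2) 0 0)) with hZ
  set Nf : ℝ := (Real.exp (2 * β) * Real.sqrt (π / β) ^ 3 / (2 * π ^ 2)) ^ Fintype.card (Edge 3 L) with hNf
  set S : ℝ := Real.exp (-(66 * β * ρ * tubeSigma L τ * Real.sqrt (Fintype.card (Plaquette 3 L × Fin 3) : ℝ))) with hS
  have hCK0 : 0 ≤ CK := floorCK_nonneg β ρ τ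
  have hXE1 : XE ≤ 1 := Real.exp_le_one_iff.2 (by linarith [riccatiTrialErr_nonneg (L := L) (σ := tubeSigma L τ) hμ hρ hβ.le])
  have hXD1 : XD ≤ 1 := Real.exp_le_one_iff.2 (by linarith [floorDefect_nonneg' L hβ hμ hτ])
  have hXE0 : 0 < XE := Real.exp_pos _
  have hXD0 : 0 < XD := Real.exp_pos _
  have hXγ0 : 0 < Xγ := Real.exp_pos _
  have hG0 : 0 ≤ G := by positivity
  have hZ0 : 0 < Z := Real.exp_pos _
  have hM0 : 0 < floorMass L β μ γ s := floorMass_pos β μ γ hs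
  have hT0 : 0 ≤ floorTail L β ρ := floorTail_nonneg hβ ρ
  -- the remainder is nonnegative: drop it
  have hrem : 0 ≤ (CK * (XE * Xγ * XD * (G * Z)) * Real.exp (-(2 * γ * τ ^ 2)) + CK * floorTail L β ρ) / floorMass L β μ γ s := by positivity
  -- the Gaussian factor in R15's shape
  have hGeq : G = (Real.sqrt (π / β) ^ 3) ^ Fintype.card (Edge 3 L) := by
    rw [hG, ← pow_mul, mul_comm]
  have hgauss : CK * G ≤ Nf * S := by
    rw [hGeq]; exact floorCK_mul_gauss_le L hβ.le hρ hτ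
  -- `m ≤ CK·G·Z·Xγ ≤ Nf·S·Z·Xγ`
  have h1 : CK * (XE * Xγ * XD * (G * Z)) ≤ CK * G * Z * Xγ := by
    have hx : XE * XD ≤ 1 := by nlinarith
    have h0 : 0 ≤ CK * G * Z * Xγ := by positivity
    calc CK * (XE * Xγ * XD * (G * Z)) = (CK * G * Z * Xγ) * (XE * XD) := by ring
      _ ≤ (CK * G * Z * Xγ) * 1 := mul_le_mul_of_nonneg_left hx h0
      _ = CK * G * Z * Xγ := mul_one _
  have h2 : CK * G * Z * Xγ ≤ Nf * S * Z * Xγ :=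
    mul_le_mul_of_nonneg_right (mul_le_mul_of_nonneg_right hgauss hZ0.le) hXγ0.le
  calc CK * (XE * Xγ * XD * (G * Z)) - (CK * (XE * Xγ * XD * (G * Z)) * Real.exp (-(2 * γ * τ ^ 2)) + CK * floorTail L β ρ) / floorMass L β μ γ s
      ≤ CK * (XE * Xγ * XD * (G * Z)) := sub_le_self _ hrem
    _ ≤ Nf * S * Z * Xγ := h1.trans h2
    _ = Nf * Z * S * Xγ := by ring

/-! ## §4 ★★ The F5 floor is below the F6 target: `c ≥ 1/6` (log design), `c ≥ 17/150` (the polynomial scales of `…FloorScales`) -/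

/-- ★★ **Log design**: for `c ≥ 1/6`, `A, C > 0`, eventually in `β`, for every soft cap `μ > 0`, cut-off strength `γ ≥ 0`, tube radius `τ ≥ A·β^{−1/3}`, chart radius with
`C·log β/β ≤ ρ²` (`ρ ≥ 0`) and cube size `s > 0`, the pre-asymptotic floor of `levelValue_zero_ge_floor` is `< Λ_id(β)·e^{−β^{−c}}`: `VacuumFloorAt L Λ_id (β^{−c})`
cannot be read off F5 for any `c ≥ 1/6`. [cite: Luscher1983, §3] -/
theorem floorF5_lt_idealFloor_target (L : ℕ) [NeZero L] {c A C : ℝ} (hc : 1 / 6 ≤ c) (hA : 0 < A) (hC : 0 < C) :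
    ∃ β0 : ℝ, ∀ β : ℝ, β0 ≤ β → ∀ μ γ ρ τ s : ℝ, 0 < μ → 0 ≤ γ → A * β ^ (-(1 / 3 : ℝ)) ≤ τ → C * Real.log β / β ≤ ρ ^ 2 → 0 ≤ ρ → 0 < s →
      floorCK L β ρ τ * (Real.exp (-riccatiTrialErr L β μ ρ (tubeSigma L τ)) * Real.exp (-(γ * (2 * τ * chartMove L ρ + chartMove L ρ ^ 2))) *
          Real.exp (-floorDefect L β μ τ) * (Real.sqrt (π / β) ^ (Fintype.card (Edge 3 L) * 3) * Real.exp (-(6 * toronZPE L (1 / 2) 0 0)))) -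
        (floorCK L β ρ τ * (Real.exp (-riccatiTrialErr L β μ ρ (tubeSigma L τ)) * Real.exp (-(γ * (2 * τ * chartMove L ρ + chartMove L ρ ^ 2))) *
          Real.exp (-floorDefect L β μ τ) * (Real.sqrt (π / β) ^ (Fintype.card (Edge 3 L) * 3) * Real.exp (-(6 * toronZPE L (1 / 2) 0 0)))) *
            Real.exp (-(2 * γ * τ ^ 2)) + floorCK L β ρ τ * floorTail L β ρ) / floorMass L β μ γ s <
      (Real.exp (2 * β) * Real.sqrt (π / β) ^ 3 / (2 * π ^ 2)) ^ Fintype.card (Edge 3 L) * Real.exp (-(6 * toronZPE L (1 / 2) 0 0)) *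
        Real.exp (-(β ^ (-c))) := by
  obtain ⟨β0, hβ0⟩ := multiplier_lt_idealFloor_target L hc hA hC
  refine ⟨max β0 1, fun β hβ μ γ ρ τ s hμ hγ hτ hρ2 hρ hs => ?_⟩
  have hβ1 : 1 ≤ β := (le_max_right _ _).trans hβ
  have hβpos : 0 < β := by linarith
  have ht0 : 0 < β ^ (-(1 / 3 : ℝ)) := Real.rpow_pos_of_pos hβpos _
  have hτ0 : 0 ≤ τ := le_trans (by positivity) hτ
  set CK : ℝ := floorCK L β ρ τ with hCK
  set XE : ℝ := Real.exp (-riccatiTrialErr L β μ ρ (tubeSigma L τ)) with hXE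
  set Xγ : ℝ := Real.exp (-(γ * (2 * τ * chartMove L ρ + chartMove L ρ ^ 2))) with hXγ
  set XD : ℝ := Real.exp (-floorDefect L β μ τ) with hXD
  set G : ℝ := Real.sqrt (π / β) ^ (Fintype.card (Edge 3 L) * 3) with hG
  set Z : ℝ := Real.exp (-(6 * toronZPE L (1 / 2) 0 0)) with hZ
  have hCK0 : 0 ≤ CK := floorCK_nonneg β ρ τ
  have hXE1 : XE ≤ 1 := Real.exp_le_one_iff.2 (by linarith [riccatiTrialErr_nonneg (L := L) (σ := tubeSigma L τ) hμ hρ hβpos.le])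
  have hXD1 : XD ≤ 1 := Real.exp_le_one_iff.2 (by linarith [floorDefect_nonneg' L hβpos hμ hτ0])
  have hXγ1 : Xγ ≤ 1 := Real.exp_le_one_iff.2 (by
    have := chartMove_nonneg (L := L) hρ
    nlinarith [mul_nonneg hγ (add_nonneg (mul_nonneg (mul_nonneg (by norm_num : (0:ℝ) ≤ 2) hτ0) this) (sq_nonneg (chartMove L ρ)))])
  have hXE0 : 0 < XE := Real.exp_pos _
  have hXD0 : 0 < XD := Real.exp_pos _
  have hXγ0 : 0 < Xγ := Real.exp_pos _
  have hG0 : 0 ≤ G := by positivity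
  have hZ0 : 0 < Z := Real.exp_pos _
  have hM0 : 0 < floorMass L β μ γ s := floorMass_pos β μ γ hs
  have hT0 : 0 ≤ floorTail L β ρ := floorTail_nonneg hβpos ρ
  have hrem : 0 ≤ (CK * (XE * Xγ * XD * (G * Z)) * Real.exp (-(2 * γ * τ ^ 2)) + CK * floorTail L β ρ) / floorMass L β μ γ s := by positivity
  -- the product of the three remaining factors is in `[0, 1]`
  have hX0 : 0 ≤ XE * Xγ * XD := by positivity
  have hX1 : XE * Xγ * XD ≤ 1 := by
    have h1 : XE * Xγ ≤ 1 := by nlinarith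
    nlinarith
  have hGeq : G = (Real.sqrt (π / β) ^ 3) ^ Fintype.card (Edge 3 L) := by rw [hG, ← pow_mul, mul_comm]
  have hmain := hβ0 β ((le_max_left _ _).trans hβ) ρ τ (XE * Xγ * XD) hτ hρ2 hρ hX0 hX1
  rw [← hGeq] at hmain
  calc CK * (XE * Xγ * XD * (G * Z)) - (CK * (XE * Xγ * XD * (G * Z)) * Real.exp (-(2 * γ * τ ^ 2)) + CK * floorTail L β ρ) / floorMass L β μ γ s
      ≤ CK * (XE * Xγ * XD * (G * Z)) := sub_le_self _ hrem
    _ = CK * (XE * Xγ * XD) * G * Z := by ring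
    _ < _ := hmain

/-- ★★ **The polynomial scales of `…FloorScales`** (`τ = β^{−1/3}`, `ρ = β^{−12/25}`, `γ = β^{7/10}`): for every `c ≥ 17/150`, EVERY `β ≥ 1`, every `μ > 0` and `s > 0`,
the pre-asymptotic floor of `levelValue_zero_ge_floor` is `< Λ_id(β)·e^{−β^{−c}}` — the cut-off cross term `γ·2τ·δ₁ = 2√2·|E|·β^{−17/150}` alone exceeds `β^{−c}`;
so a `VacuumFloorAt L Λ_id tol` read off F5 at these scales has `tol(β) > 2√2|E|·β^{−17/150}` (the announced `K·β^{−1/10}` is consistent). [cite: Luscher1983, §3] -/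
theorem floorF5_lt_idealFloor_target_scales (L : ℕ) [NeZero L] {c : ℝ} (hc : 17 / 150 ≤ c) {β μ s : ℝ} (hβ : 1 ≤ β) (hμ : 0 < μ) (hs : 0 < s) :
    floorCK L β (β ^ (-(12 / 25 : ℝ))) (β ^ (-(1 / 3 : ℝ))) *
          (Real.exp (-riccatiTrialErr L β μ (β ^ (-(12 / 25 : ℝ))) (tubeSigma L (β ^ (-(1 / 3 : ℝ))))) *
            Real.exp (-(β ^ (7 / 10 : ℝ) * (2 * β ^ (-(1 / 3 : ℝ)) * chartMove L (β ^ (-(12 / 25 : ℝ))) + chartMove L (β ^ (-(12 / 25 : ℝ))) ^ 2))) *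
            Real.exp (-floorDefect L β μ (β ^ (-(1 / 3 : ℝ)))) *
            (Real.sqrt (π / β) ^ (Fintype.card (Edge 3 L) * 3) * Real.exp (-(6 * toronZPE L (1 / 2) 0 0)))) -
        (floorCK L β (β ^ (-(12 / 25 : ℝ))) (β ^ (-(1 / 3 : ℝ))) *
            (Real.exp (-riccatiTrialErr L β μ (β ^ (-(12 / 25 : ℝ))) (tubeSigma L (β ^ (-(1 / 3 : ℝ))))) *
              Real.exp (-(β ^ (7 / 10 : ℝ) * (2 * β ^ (-(1 / 3 : ℝ)) * chartMove L (β ^ (-(12 / 25 : ℝ))) + chartMove L (β ^ (-(12 / 25 : ℝ))) ^ 2))) *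
              Real.exp (-floorDefect L β μ (β ^ (-(1 / 3 : ℝ)))) *
              (Real.sqrt (π / β) ^ (Fintype.card (Edge 3 L) * 3) * Real.exp (-(6 * toronZPE L (1 / 2) 0 0)))) *
            Real.exp (-(2 * β ^ (7 / 10 : ℝ) * (β ^ (-(1 / 3 : ℝ))) ^ 2)) +
          floorCK L β (β ^ (-(12 / 25 : ℝ))) (β ^ (-(1 / 3 : ℝ))) * floorTail L β (β ^ (-(12 / 25 : ℝ)))) /
          floorMass L β μ (β ^ (7 / 10 : ℝ)) s <
      (Real.exp (2 * β) * Real.sqrt (π / β) ^ 3 / (2 * π ^ 2)) ^ Fintype.card (Edge 3 L) * Real.exp (-(6 * toronZPE L (1 / 2) 0 0)) *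
        Real.exp (-(β ^ (-c))) := by
  have hβpos : 0 < β := by linarith
  set u : ℝ := β ^ (-(1 / 3 : ℝ)) with hu
  set v : ℝ := β ^ (-(12 / 25 : ℝ)) with hv
  set γ : ℝ := β ^ (7 / 10 : ℝ) with hγ
  have hu0 : 0 < u := Real.rpow_pos_of_pos hβpos _
  have hv0 : 0 < v := Real.rpow_pos_of_pos hβpos _
  have hγ0 : 0 < γ := Real.rpow_pos_of_pos hβpos _
  have hle := floorF5_le L (μ := μ) (γ := γ) hβpos hμ hv0.le hu0.le hs
  set Nf : ℝ := (Real.exp (2 * β) * Real.sqrt (π / β) ^ 3 / (2 * π ^ 2)) ^ Fintype.card (Edge 3 L) with hNf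
  set Z : ℝ := Real.exp (-(6 * toronZPE L (1 / 2) 0 0)) with hZ
  set S : ℝ := Real.exp (-(66 * β * v * tubeSigma L u * Real.sqrt (Fintype.card (Plaquette 3 L × Fin 3) : ℝ))) with hS
  have hNf0 : 0 < Nf := by positivity
  have hZ0 : 0 < Z := Real.exp_pos _
  have hS1 : S ≤ 1 := Real.exp_le_one_iff.2 (by
    have := tubeSigma_nonneg L hu0.le
    have : 0 ≤ 66 * β * v * tubeSigma L u * Real.sqrt (Fintype.card (Plaquette 3 L × Fin 3) : ℝ) := by positivity
    linarith)
  -- the cross term: `γ·(2uδ₁ + δ₁²) ≥ 2γuδ₁ = 2√2|E|·β^{−17/150} > β^{−c}`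
  obtain ⟨-, -, h3E⟩ := R13.one_le_cards L
  have hE1 : (1 : ℝ) ≤ (Fintype.card (Edge 3 L) : ℝ) := by
    have : (3 : ℝ) ≤ ((Fintype.card (Edge 3 L) * 3 : ℕ) : ℝ) := h3E
    push_cast at this
    linarith
  have hmono : γ * u * v = β ^ (-(17 / 150 : ℝ)) := by
    rw [hγ, hu, hv, ← Real.rpow_add hβpos, ← Real.rpow_add hβpos]; norm_num
  have hδ : chartMove L v = (Fintype.card (Edge 3 L) : ℝ) * (Real.sqrt 2 * v) := rfl
  have hsqrt2 : (1 : ℝ) < Real.sqrt 2 := by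
    rw [show (1 : ℝ) = Real.sqrt 1 by rw [Real.sqrt_one]]
    exact Real.sqrt_lt_sqrt (by norm_num) (by norm_num)
  have h17 : 0 < β ^ (-(17 / 150 : ℝ)) := Real.rpow_pos_of_pos hβpos _
  have hc17 : β ^ (-c) ≤ β ^ (-(17 / 150 : ℝ)) := Real.rpow_le_rpow_of_exponent_le hβ (by linarith)
  have hcross : β ^ (-c) < γ * (2 * u * chartMove L v + chartMove L v ^ 2) := by
    have h1 : γ * (2 * u * chartMove L v) = 2 * Real.sqrt 2 * (Fintype.card (Edge 3 L) : ℝ) * (γ * u * v) := by rw [hδ]; ring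
    have h2 : 0 ≤ γ * chartMove L v ^ 2 := by positivity
    have h3 : β ^ (-(17 / 150 : ℝ)) < 2 * Real.sqrt 2 * (Fintype.card (Edge 3 L) : ℝ) * β ^ (-(17 / 150 : ℝ)) := by
      have hk : (1 : ℝ) < 2 * Real.sqrt 2 * (Fintype.card (Edge 3 L) : ℝ) := by nlinarith
      have := mul_lt_mul_of_pos_right hk h17
      rwa [one_mul] at this
    have h4 : γ * (2 * u * chartMove L v + chartMove L v ^ 2) = γ * (2 * u * chartMove L v) + γ * chartMove L v ^ 2 := by ring
    rw [h4, h1, hmono]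
    linarith
  have hXγ : Real.exp (-(γ * (2 * u * chartMove L v + chartMove L v ^ 2))) < Real.exp (-(β ^ (-c))) := Real.exp_lt_exp.2 (by linarith)
  calc _ ≤ Nf * Z * S * Real.exp (-(γ * (2 * u * chartMove L v + chartMove L v ^ 2))) := hle
    _ ≤ Nf * Z * 1 * Real.exp (-(γ * (2 * u * chartMove L v + chartMove L v ^ 2))) :=
        mul_le_mul_of_nonneg_right (mul_le_mul_of_nonneg_left hS1 (by positivity)) (Real.exp_pos _).le
    _ < Nf * Z * 1 * Real.exp (-(β ^ (-c))) := mul_lt_mul_of_pos_left hXγ (by positivity)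
    _ = Nf * Z * Real.exp (-(β ^ (-c))) := by ring

end Summit.QuantumFields.YangMills.Theorems.TwistedTraceScaling.Negative.R15

end
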